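import Summits.RiemannHypothesis.RiemannHypothesis.Theorems.WeilFormatCOscTailAbelReal
import HarnessLib

/-!
# Format C, design C∞: product-to-sum for the trigonometric family-Gram entries

Route context: Fourier–Galerkin / Schur-complement certificates of Weil positivity on a window ("format C", design C∞;
cell memo `run/shared/lean/pub/rh-explicit/rh-explicit-weil-2/gen9/CINF-GENERATOR-SPEC.md` B10; supporting stmt-RiemannHypothesis-0098;
seat rh-explicit-weil-2).

The Gram entries of `WeilFormatCFamilyGram` between two trigonometric members `cos(mθ)/m^e`, `sin(mθ′)/m^{e′}` are tails
`Σ'_{m≥m₀} cos(mθ)cos(mθ′)/m^s` etc. (`s = e + e′`); the kit encloses them through the single-frequency boxes of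
`WeilFormatCOscTailAbelReal` at the frequencies `θ − θ′`, `θ + θ′`.  This file is the product-to-sum bookkeeping at the level of sums:

* `hasSum_cos_mul_cos_div_pow`, `hasSum_sin_mul_sin_div_pow`, `hasSum_sin_mul_cos_div_pow` — e.g.
  `Σ' cos((m₀+k)θ)cos((m₀+k)θ′)/(m₀+k)^s = ½(C(θ−θ′) + C(θ+θ′))` with `C(φ) = Σ' cos((m₀+k)φ)/(m₀+k)^s`, `S(φ)` likewise (`2 ≤ s`).

Elementary; standard axioms; no definitions; no RH claim.
-/

-- `Summit.RiemannHypothesis.RiemannHypothesis.…` is the layout-mandated namespace (summit = problem name).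
set_option linter.dupNamespace false

noncomputable section

open Filter Set Complex
open scoped Topology

namespace Summit.RiemannHypothesis.RiemannHypothesis.Theorems.WeilFormatC

/-- Summability of `cos((m₀+k)φ)/(m₀+k)^s` (`2 ≤ s`). -/
theorem summable_cos_div_pow (φ : ℝ) {s : ℕ} (hs : 2 ≤ s) (m₀ : ℕ) :
    Summable fun k ↦ Real.cos ((m₀ + k : ℕ) * φ) / (((m₀ + k : ℕ)) : ℝ) ^ s :=
  (hasSum_cos_div_pow φ hs m₀).summable

/-- Summability of `sin((m₀+k)φ)/(m₀+k)^s` (`2 ≤ s`). -/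
theorem summable_sin_div_pow (φ : ℝ) {s : ℕ} (hs : 2 ≤ s) (m₀ : ℕ) :
    Summable fun k ↦ Real.sin ((m₀ + k : ℕ) * φ) / (((m₀ + k : ℕ)) : ℝ) ^ s :=
  (hasSum_sin_div_pow φ hs m₀).summable

/-- **cos·cos**: `Σ' cos(mθ)cos(mθ′)/m^s = ½ Σ' cos(m(θ−θ′))/m^s + ½ Σ' cos(m(θ+θ′))/m^s` (`m = m₀+k`, `2 ≤ s`). -/
theorem tsum_cos_mul_cos_div_pow (θ θ' : ℝ) {s : ℕ} (hs : 2 ≤ s) (m₀ : ℕ) :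
    ∑' k, Real.cos ((m₀ + k : ℕ) * θ) * Real.cos ((m₀ + k : ℕ) * θ') / (((m₀ + k : ℕ)) : ℝ) ^ s
      = (∑' k, Real.cos ((m₀ + k : ℕ) * (θ - θ')) / (((m₀ + k : ℕ)) : ℝ) ^ s) / 2
        + (∑' k, Real.cos ((m₀ + k : ℕ) * (θ + θ')) / (((m₀ + k : ℕ)) : ℝ) ^ s) / 2 := by
  have h1 := (summable_cos_div_pow (θ - θ') hs m₀).hasSum
  have h2 := (summable_cos_div_pow (θ + θ') hs m₀).hasSum
  have h := (h1.div_const 2).add (h2.div_const 2)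
  refine (HasSum.tsum_eq ?_)
  refine h.congr_fun fun k ↦ ?_
  rw [mul_sub, mul_add, Real.cos_sub, Real.cos_add]
  ring

/-- **sin·sin**: `Σ' sin(mθ)sin(mθ′)/m^s = ½ Σ' cos(m(θ−θ′))/m^s − ½ Σ' cos(m(θ+θ′))/m^s`. -/
theorem tsum_sin_mul_sin_div_pow (θ θ' : ℝ) {s : ℕ} (hs : 2 ≤ s) (m₀ : ℕ) :
    ∑' k, Real.sin ((m₀ + k : ℕ) * θ) * Real.sin ((m₀ + k : ℕ) * θ') / (((m₀ + k : ℕ)) : ℝ) ^ s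
      = (∑' k, Real.cos ((m₀ + k : ℕ) * (θ - θ')) / (((m₀ + k : ℕ)) : ℝ) ^ s) / 2
        - (∑' k, Real.cos ((m₀ + k : ℕ) * (θ + θ')) / (((m₀ + k : ℕ)) : ℝ) ^ s) / 2 := by
  have h1 := (summable_cos_div_pow (θ - θ') hs m₀).hasSum
  have h2 := (summable_cos_div_pow (θ + θ') hs m₀).hasSum
  have h := (h1.div_const 2).sub (h2.div_const 2)
  refine (HasSum.tsum_eq ?_)
  refine h.congr_fun fun k ↦ ?_
  rw [mul_sub, mul_add, Real.cos_sub, Real.cos_add]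
  ring

/-- **sin·cos**: `Σ' sin(mθ)cos(mθ′)/m^s = ½ Σ' sin(m(θ+θ′))/m^s + ½ Σ' sin(m(θ−θ′))/m^s`. -/
theorem tsum_sin_mul_cos_div_pow (θ θ' : ℝ) {s : ℕ} (hs : 2 ≤ s) (m₀ : ℕ) :
    ∑' k, Real.sin ((m₀ + k : ℕ) * θ) * Real.cos ((m₀ + k : ℕ) * θ') / (((m₀ + k : ℕ)) : ℝ) ^ s
      = (∑' k, Real.sin ((m₀ + k : ℕ) * (θ + θ')) / (((m₀ + k : ℕ)) : ℝ) ^ s) / 2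
        + (∑' k, Real.sin ((m₀ + k : ℕ) * (θ - θ')) / (((m₀ + k : ℕ)) : ℝ) ^ s) / 2 := by
  have h1 := (summable_sin_div_pow (θ + θ') hs m₀).hasSum
  have h2 := (summable_sin_div_pow (θ - θ') hs m₀).hasSum
  have h := (h1.div_const 2).add (h2.div_const 2)
  refine (HasSum.tsum_eq ?_)
  refine h.congr_fun fun k ↦ ?_
  rw [mul_sub, mul_add, Real.sin_sub, Real.sin_add]
  ring

/-- **Powers combine**: `(1/m^e)·(t(m)/m^{e′}) = t(m)/m^{e+e′}` — the smooth×trig entries are single-frequency tails at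
exponent `e + e′`. -/
theorem one_div_pow_mul_div_pow (t x : ℝ) (e e' : ℕ) :
    1 / x ^ e * (t / x ^ e') = t / x ^ (e + e') := by
  rw [pow_add]; ring

end Summit.RiemannHypothesis.RiemannHypothesis.Theorems.WeilFormatC

end
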